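import Summits.RiemannHypothesis.RiemannHypothesis.Theorems.SignConeKreinTuranSchur
import Summits.RiemannHypothesis.RiemannHypothesis.Theorems.SignConeCondRungCoefTable
import Mathlib.MeasureTheory.Function.Floor

/-!
# Route SignCone — Krein–Turán rung, V: a kernel-checkable Schur-weight certificate format

Support for the crux `SignConeInequality` (stmt-RiemannHypothesis-16301; plan `Cruxes/SignConeInequality/KREIN-TURAN-RUNG.md` §3).
A `SchurCert` is a step weight on `K` uniform cells of `I = [-L/2, L/2]` (positive integer values `wv`), a `CoefTable` of
certified bounds `hi n ≥ 2Λ(n)/√n` (`n ≤ N`), and per node `n` four integer cell offsets `(A⁻, B⁻, A⁺, B⁺)` (stored flat,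
shifted by `2^20`) such that for
`x` in cell `j` the points `x ∓ log n`, when in `I`, lie in cells `j + A∓ … j + B∓` (validated against the interval
logarithm table `FI.logTable`: `A⁻ ≤ ⌊−t⁺/d⌋`, `⌊1 − t⁻/d⌋ ≤ B⁻`, `A⁺ ≤ ⌊t⁻/d⌋`, `⌊1 + t⁺/d⌋ ≤ B⁺` for the enclosure
`[t⁻, t⁺] ∋ log n`, `d = L/K`). The Boolean `check` then verifies, row by row,
`Σ_n (hi n / 2) (max_{j+A⁻ ≤ i ≤ j+B⁻} w_i + max_{j+A⁺ ≤ i ≤ j+B⁺} w_i) ≤ Π · w_j` (`rowSum`; only the `≤ 3` cells of each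
range are visited, zero coefficients are skipped), and `sound` turns
`check = true` into `SchurWeight N L Π w` for the step function `w` (`SignConeKreinTuranSchur`), whence the Krein–Turán bound.
Nothing about the weight is trusted; only the kernel-evaluated inequalities are used.
-/

noncomputable section

-- `Summit.RiemannHypothesis.RiemannHypothesis.…` repeats a namespace component by design (D-0017 layout).
set_option linter.dupNamespace false

open scoped BigOperators ArithmeticFunction.vonMangoldt
open MeasureTheory Set
open Literature.Analysis.ValidatedNumerics.Numerics

namespace Summit.RiemannHypothesis.RiemannHypothesis.Theorems.SignCone

/-- A Schur-weight certificate: coefficient table, `K` uniform cells on `[-L/2, L/2]`, the bound `Π`, positive integer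
cell values, and per-node cell offsets `(A⁻, B⁻, A⁺, B⁺)`. [folklore] -/
structure SchurCert where
  /-- certified bounds `hi n ≥ 2Λ(n)/√n`, `n ≤ N` -/
  coef : CoefTable
  /-- number of cells -/
  K : ℕ
  /-- length of the interval `I = [-L/2, L/2]` -/
  L : ℚ
  /-- the Schur (Krein–Turán) bound `Π` -/
  Pup : ℚ
  /-- cell values `w_0, …, w_{K-1}` -/
  wv : List ℕ
  /-- per node `n`: offsets `A⁻, B⁻, A⁺, B⁺` at positions `4n … 4n+3`, each stored `+ 2^20` (flat `ℕ` encoding) -/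
  shifts : List ℕ

namespace SchurCert

variable (c : SchurCert)

/-- Cell width `d = L/K`. [folklore] -/
def d : ℚ := c.L / c.K

/-- Cell value `w_i` (zero beyond the table). [folklore] -/
def wAt (i : ℕ) : ℚ := (c.wv.getD i 0 : ℚ)

/-- Decoded offset entry `k ∈ {0,1,2,3}` of node `n` (missing entries decode to `−2^20`, an empty range). [folklore] -/
def sh (n k : ℕ) : ℤ := ((c.shifts.getD (4 * n + k) 0 : ℕ) : ℤ) - 1048576
/-- Offset `A⁻` of node `n`. [folklore] -/
def Am (n : ℕ) : ℤ := c.sh n 0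
/-- Offset `B⁻` of node `n`. [folklore] -/
def Bm (n : ℕ) : ℤ := c.sh n 1
/-- Offset `A⁺` of node `n`. [folklore] -/
def Ap (n : ℕ) : ℤ := c.sh n 2
/-- Offset `B⁺` of node `n`. [folklore] -/
def Bp (n : ℕ) : ℤ := c.sh n 3

/-- `max { w_i : lo ≤ i ≤ hi, 0 ≤ i ≤ K-1 }` with the right-end clamp (`i = K` counts as cell `K-1`, the closed right
endpoint of `I`); `0` when `lo > K` or the range is empty. Only the `≤ 3` cells of the range are visited. [folklore] -/
def rangeMax (lo hi : ℤ) : ℚ :=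
  if (c.K : ℤ) < lo then 0 else
    ((List.range (min hi (c.K - 1) + 1 - max 0 (min lo (c.K - 1))).toNat).map fun k : ℕ =>
      c.wAt (max 0 (min lo (c.K - 1)) + (k : ℤ)).toNat).foldr max 0

/-- The certified upper bound of `(A w)(x)` for `x` in cell `j` (nodes with a zero coefficient are skipped). [folklore] -/
def rowSum (j : ℕ) : ℚ :=
  ((List.range (c.coef.N + 1)).map fun n =>
    if c.coef.hiAt n = 0 then 0 else
      c.coef.hiAt n / 2 * (c.rangeMax (j + c.Am n) (j + c.Bm n) + c.rangeMax (j + c.Ap n) (j + c.Bp n))).sum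

/-- Validation of the offsets of node `n` against the logarithm table (prime powers only). [folklore] -/
def checkShift (logs : List FI) (n : ℕ) : Bool :=
  if IsPrimePow n then
    decide (c.Am n ≤ ⌊-(logs.getD n (FI.ofInt 0)).hiQ / c.d⌋) &&
    decide (⌊1 - (logs.getD n (FI.ofInt 0)).loQ / c.d⌋ ≤ c.Bm n) &&
    decide (c.Ap n ≤ ⌊(logs.getD n (FI.ofInt 0)).loQ / c.d⌋) &&
    decide (⌊1 + (logs.getD n (FI.ofInt 0)).hiQ / c.d⌋ ≤ c.Bp n)
  else true

/-- **The whole check.** [folklore] -/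
def check : Bool :=
  c.coef.check && decide (0 < c.K) && decide (0 < c.L) &&
    (List.range (c.coef.N + 1)).all (c.checkShift (FI.logTable c.coef.N)) &&
    (List.range c.K).all (fun i => decide (0 < c.wAt i)) &&
    (List.range c.K).all (fun j => decide (c.rowSum j ≤ c.Pup * c.wAt j))

/-- The cell coordinate `q(x) = (x + L/2)/d` of a real point. [folklore] -/
def q (x : ℝ) : ℝ := (x + (c.L : ℝ) / 2) / (c.d : ℝ)

/-- The cell index of a real point: `min (K-1) ⌊q(x)⌋₊`. [folklore] -/
def cellIdx (x : ℝ) : ℕ := min (c.K - 1) (⌊c.q x⌋).toNat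

/-- **The step weight** `w(x) = w_{cellIdx x}`. [folklore] -/
def w (x : ℝ) : ℝ := (c.wAt (c.cellIdx x) : ℝ)

/-! ### Elementary facts about the tables -/

/-- `w_i ≥ 0`. [folklore] -/
theorem wAt_nonneg (i : ℕ) : 0 ≤ c.wAt i := by
  unfold wAt; exact_mod_cast Nat.zero_le _

/-- `foldr max 0 ≥ 0`. [folklore] -/
theorem foldr_max_nonneg (l : List ℚ) : 0 ≤ l.foldr max 0 := by
  induction l with
  | nil => exact le_rfl
  | cons a l ih => simp only [List.foldr_cons]; exact ih.trans (le_max_right _ _)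

/-- `foldr max 0` dominates every member. [folklore] -/
theorem le_foldr_max {l : List ℚ} {x : ℚ} (hx : x ∈ l) : x ≤ l.foldr max 0 := by
  induction l with
  | nil => exact absurd hx (by simp)
  | cons a l ih =>
    simp only [List.foldr_cons]
    rcases List.mem_cons.1 hx with rfl | h
    · exact le_max_left _ _
    · exact (ih h).trans (le_max_right _ _)

/-- `rangeMax ≥ 0`. [folklore] -/
theorem rangeMax_nonneg (lo hi : ℤ) : 0 ≤ c.rangeMax lo hi := by
  unfold rangeMax
  split_ifs
  · exact le_rfl
  · exact foldr_max_nonneg _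

/-- **Lookup**: if `lo ≤ k ≤ hi` and `0 ≤ k ≤ K` then `w_{min (K-1) k} ≤ rangeMax lo hi`. [folklore] -/
theorem wAt_le_rangeMax (hK : 0 < c.K) {lo hi k : ℤ} (h1 : lo ≤ k) (h2 : k ≤ hi) (h3 : 0 ≤ k) (h4 : k ≤ c.K) :
    c.wAt (min (c.K - 1) k.toNat) ≤ c.rangeMax lo hi := by
  unfold rangeMax
  rw [if_neg (by omega)]
  refine le_foldr_max (List.mem_map.2 ⟨((min ((c.K : ℤ) - 1) k) - max 0 (min lo (c.K - 1))).toNat,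
    List.mem_range.2 ?_, ?_⟩)
  · have : max 0 (min lo ((c.K : ℤ) - 1)) ≤ min ((c.K : ℤ) - 1) k := by omega
    omega
  · congr 1
    have hk : (k.toNat : ℤ) = k := Int.toNat_of_nonneg h3
    have e1 : ((min (c.K - 1) k.toNat : ℕ) : ℤ) = min ((c.K : ℤ) - 1) k := by
      rw [Nat.cast_min, hk, Nat.cast_sub (by omega)]; simp
    omega

/-! ### Soundness -/

/-- Unpacking `check`. [folklore] -/
theorem check_spec (h : c.check = true) :
    c.coef.check = true ∧ 0 < c.K ∧ 0 < c.L ∧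
      (∀ n ≤ c.coef.N, c.checkShift (FI.logTable c.coef.N) n = true) ∧
      (∀ i < c.K, 0 < c.wAt i) ∧ (∀ j < c.K, c.rowSum j ≤ c.Pup * c.wAt j) := by
  unfold check at h
  simp only [Bool.and_eq_true, List.all_eq_true, List.mem_range, decide_eq_true_eq] at h
  obtain ⟨⟨⟨⟨⟨h1, h2⟩, h3⟩, h4⟩, h5⟩, h6⟩ := h
  exact ⟨h1, h2, h3, fun n hn => h4 n (by omega), h5, h6⟩

/-- The cell index lies below `K` (when `K > 0`). [folklore] -/
theorem cellIdx_lt (hK : 0 < c.K) (x : ℝ) : c.cellIdx x < c.K := by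
  unfold cellIdx; omega

/-- For `x ∈ I`: `0 ≤ q(x) ≤ K`. [folklore] -/
theorem q_bounds (hK : 0 < c.K) (hL : 0 < c.L) {x : ℝ} (hx : x ∈ Icc (-((c.L : ℝ) / 2)) ((c.L : ℝ) / 2)) :
    0 ≤ c.q x ∧ c.q x ≤ c.K := by
  have hd : (0 : ℝ) < c.d := by
    unfold d; push_cast; exact div_pos (by exact_mod_cast hL) (by exact_mod_cast hK)
  refine ⟨div_nonneg (by linarith [hx.1]) hd.le, ?_⟩
  unfold q
  rw [div_le_iff₀ hd]
  have : (c.d : ℝ) * c.K = c.L := by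
    unfold d; push_cast; field_simp
  nlinarith [hx.2, this]

/-- For `x ∈ I` and `j = cellIdx x`: `j ≤ q(x) ≤ j + 1`. [folklore] -/
theorem cellIdx_spec (hK : 0 < c.K) (hL : 0 < c.L) {x : ℝ} (hx : x ∈ Icc (-((c.L : ℝ) / 2)) ((c.L : ℝ) / 2)) :
    ((c.cellIdx x : ℤ) : ℝ) ≤ c.q x ∧ c.q x ≤ (c.cellIdx x : ℤ) + 1 := by
  obtain ⟨hq0, hqK⟩ := c.q_bounds hK hL hx
  have hf0 : 0 ≤ ⌊c.q x⌋ := Int.floor_nonneg.2 hq0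
  have hfK : ⌊c.q x⌋ ≤ c.K := Int.floor_le_floor hqK |>.trans (by simp)
  have hcast : ((c.cellIdx x : ℕ) : ℤ) = min ((c.K : ℤ) - 1) ⌊c.q x⌋ := by
    unfold cellIdx
    rw [Nat.cast_min, Int.toNat_of_nonneg hf0, Nat.cast_sub (by omega)]
    simp
  rw [hcast]
  constructor
  · calc ((min ((c.K : ℤ) - 1) ⌊c.q x⌋ : ℤ) : ℝ) ≤ ((⌊c.q x⌋ : ℤ) : ℝ) := by exact_mod_cast min_le_right _ _
      _ ≤ c.q x := Int.floor_le _
  · rcases le_or_gt ⌊c.q x⌋ ((c.K : ℤ) - 1) with h | h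
    · rw [min_eq_right h]; exact (Int.lt_floor_add_one _).le
    · rw [min_eq_left h.le]
      have : ((((c.K : ℤ) - 1 : ℤ) : ℝ)) + 1 = c.K := by push_cast; ring
      rw [this]; exact hqK

/-- **Key lookup lemma**: for `x` in cell `j` of `I` and `y = x + s ∈ I` with `⌊(y + L/2)/d⌋ ∈ [lo, hi]`,
`w(y) ≤ rangeMax lo hi`. [folklore] -/
theorem w_le_rangeMax (hK : 0 < c.K) (hL : 0 < c.L) {y : ℝ} (hy : y ∈ Icc (-((c.L : ℝ) / 2)) ((c.L : ℝ) / 2))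
    {lo hi : ℤ} (h1 : lo ≤ ⌊c.q y⌋) (h2 : ⌊c.q y⌋ ≤ hi) :
    c.w y ≤ c.rangeMax lo hi := by
  obtain ⟨hq0, hqK⟩ := c.q_bounds hK hL hy
  have hf0 : 0 ≤ ⌊c.q y⌋ := Int.floor_nonneg.2 hq0
  have hfK : ⌊c.q y⌋ ≤ c.K := Int.floor_le_floor hqK |>.trans (by simp)
  unfold w cellIdx
  exact_mod_cast c.wAt_le_rangeMax hK h1 h2 hf0 hfK

/-- **Soundness of the certificate.** [folklore] -/
theorem sound (h : c.check = true) {N : ℕ} {L P : ℝ} (hN : c.coef.N = N) (hLr : (c.L : ℝ) = L) (hP : (c.Pup : ℝ) = P) :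
    SchurWeight N L P c.w := by
  obtain ⟨hcoef, hK, hL, hshift, hpos, hrow⟩ := c.check_spec h
  subst hN hLr hP
  have hd : (0 : ℝ) < c.d := by
    unfold d; push_cast; exact div_pos (by exact_mod_cast hL) (by exact_mod_cast hK)
  have hlogs : FI.logTableOK c.coef.N = true := by
    unfold CoefTable.check at hcoef; rw [Bool.and_eq_true] at hcoef; exact hcoef.1
  refine ⟨?_, ?_, ?_⟩
  -- measurability
  · have e : c.w = (fun k : ℤ => (c.wAt (min (c.K - 1) k.toNat) : ℝ)) ∘ fun x : ℝ => ⌊c.q x⌋ := by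
      funext x; rfl
    have hqm : Measurable c.q := by
      have : c.q = fun x : ℝ => (x + (c.L : ℝ) / 2) / (c.d : ℝ) := rfl
      rw [this]; fun_prop
    rw [e]
    exact measurable_from_top.comp (Int.measurable_floor.comp hqm)
  -- positivity and boundedness on I
  · classical
    have hne : ((Finset.range c.K).image c.wAt).Nonempty := ⟨c.wAt 0, Finset.mem_image.2 ⟨0, by simp [hK], rfl⟩⟩
    refine ⟨(((Finset.range c.K).image c.wAt).min' hne : ℚ), (((Finset.range c.K).image c.wAt).max' hne : ℚ), ?_, ?_⟩
    · have hm := Finset.min'_mem _ hne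
      obtain ⟨i, hi, he⟩ := Finset.mem_image.1 hm
      rw [← he]; exact_mod_cast hpos i (Finset.mem_range.1 hi)
    · intro x _
      have hmem : c.wAt (c.cellIdx x) ∈ (Finset.range c.K).image c.wAt :=
        Finset.mem_image.2 ⟨_, Finset.mem_range.2 (c.cellIdx_lt hK x), rfl⟩
      unfold w
      exact ⟨by exact_mod_cast Finset.min'_le _ _ hmem, by exact_mod_cast Finset.le_max' _ _ hmem⟩
  -- the Schur inequality
  · intro x hx
    set I : Set ℝ := Icc (-((c.L : ℝ) / 2)) ((c.L : ℝ) / 2) with hI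
    set j : ℕ := c.cellIdx x with hj
    have hjK : j < c.K := c.cellIdx_lt hK x
    obtain ⟨hq1, hq2⟩ := c.cellIdx_spec hK hL hx
    rw [← hj] at hq1 hq2
    push_cast at hq1 hq2
    have hwx : c.w x = c.wAt j := rfl
    -- termwise bound
    have hterm : ∀ n ∈ Finset.range (c.coef.N + 1),
        (2 * Λ n / Real.sqrt n) / 2 * (I.indicator c.w (x - Real.log n) + I.indicator c.w (x + Real.log n)) ≤
          (((if c.coef.hiAt n = 0 then 0 else
            c.coef.hiAt n / 2 * (c.rangeMax (j + c.Am n) (j + c.Bm n) + c.rangeMax (j + c.Ap n) (j + c.Bp n))) : ℚ) : ℝ) := by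
      intro n hn
      rw [Finset.mem_range] at hn
      obtain ⟨h0, hb⟩ := c.coef.sound hcoef (n := n) (by omega)
      have hR1 := c.rangeMax_nonneg (j + c.Am n) (j + c.Bm n)
      have hR2 := c.rangeMax_nonneg (j + c.Ap n) (j + c.Bp n)
      have ha : 0 ≤ 2 * Λ n / Real.sqrt n :=
        div_nonneg (mul_nonneg zero_le_two ArithmeticFunction.vonMangoldt_nonneg) (Real.sqrt_nonneg _)
      by_cases hz : c.coef.hiAt n = 0
      · -- zero coefficient: the honest weight vanishes too
        rw [if_pos hz]
        rw [hz] at hb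
        push_cast at hb ⊢
        have ha0 : 2 * Λ n / Real.sqrt n = 0 := le_antisymm hb ha
        rw [ha0]; simp
      rw [if_neg hz]
      push_cast
      by_cases hp : IsPrimePow n
      · -- the offsets are validated
        have hs := hshift n (by omega)
        unfold checkShift at hs
        simp only [hp, if_true, Bool.and_eq_true, decide_eq_true_eq] at hs
        obtain ⟨⟨⟨hA1, hB1⟩, hA2⟩, hB2⟩ := hs
        have hmem := FI.mem_logTable hlogs (show n ≤ c.coef.N by omega)
        have htlo := FI.loQ_le hmem
        have hthi := FI.le_hiQ hmem
        set t : ℝ := Real.log n with ht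
        set F := (FI.logTable c.coef.N).getD n (FI.ofInt 0) with hF
        -- indicator bounds
        have hind1 : I.indicator c.w (x - t) ≤ c.rangeMax (j + c.Am n) (j + c.Bm n) := by
          by_cases hy : x - t ∈ I
          · rw [indicator_of_mem hy]
            refine c.w_le_rangeMax hK hL hy ?_ ?_
            · have e : c.q (x - t) = c.q x - t / (c.d : ℝ) := by unfold q; ring
              have hlow : ((j : ℤ) : ℝ) + ((-(F.hiQ) / c.d : ℚ) : ℝ) ≤ c.q (x - t) := by
                rw [e]; push_cast
                have : t / (c.d : ℝ) ≤ (F.hiQ : ℝ) / (c.d : ℝ) := div_le_div_of_nonneg_right hthi hd.le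
                have e2 : -(F.hiQ : ℝ) / (c.d : ℝ) = -((F.hiQ : ℝ) / (c.d : ℝ)) := by ring
                linarith
              have := Int.floor_le_floor hlow
              rw [Int.floor_intCast_add, Rat.floor_cast] at this
              exact le_trans (by linarith [hA1]) this
            · have e : c.q (x - t) = c.q x - t / (c.d : ℝ) := by unfold q; ring
              have hup : c.q (x - t) ≤ ((j : ℤ) : ℝ) + ((1 - F.loQ / c.d : ℚ) : ℝ) := by
                rw [e]; push_cast
                have : (F.loQ : ℝ) / (c.d : ℝ) ≤ t / (c.d : ℝ) := div_le_div_of_nonneg_right htlo hd.le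
                linarith
              have := Int.floor_le_floor hup
              rw [Int.floor_intCast_add, Rat.floor_cast] at this
              exact this.trans (by linarith [hB1])
          · rw [indicator_of_notMem hy]; exact_mod_cast hR1
        have hind2 : I.indicator c.w (x + t) ≤ c.rangeMax (j + c.Ap n) (j + c.Bp n) := by
          by_cases hy : x + t ∈ I
          · rw [indicator_of_mem hy]
            refine c.w_le_rangeMax hK hL hy ?_ ?_
            · have e : c.q (x + t) = c.q x + t / (c.d : ℝ) := by unfold q; ring
              have hlow : ((j : ℤ) : ℝ) + ((F.loQ / c.d : ℚ) : ℝ) ≤ c.q (x + t) := by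
                rw [e]; push_cast
                have : (F.loQ : ℝ) / (c.d : ℝ) ≤ t / (c.d : ℝ) := div_le_div_of_nonneg_right htlo hd.le
                linarith
              have := Int.floor_le_floor hlow
              rw [Int.floor_intCast_add, Rat.floor_cast] at this
              exact le_trans (by linarith [hA2]) this
            · have e : c.q (x + t) = c.q x + t / (c.d : ℝ) := by unfold q; ring
              have hup : c.q (x + t) ≤ ((j : ℤ) : ℝ) + ((1 + F.hiQ / c.d : ℚ) : ℝ) := by
                rw [e]; push_cast
                have : t / (c.d : ℝ) ≤ (F.hiQ : ℝ) / (c.d : ℝ) := div_le_div_of_nonneg_right hthi hd.le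
                linarith
              have := Int.floor_le_floor hup
              rw [Int.floor_intCast_add, Rat.floor_cast] at this
              exact this.trans (by linarith [hB2])
          · rw [indicator_of_notMem hy]; exact_mod_cast hR2
        have hsum := add_le_add hind1 hind2
        have hR : (0 : ℝ) ≤ c.rangeMax (j + c.Am n) (j + c.Bm n) + c.rangeMax (j + c.Ap n) (j + c.Bp n) := by
          exact_mod_cast add_nonneg hR1 hR2
        calc 2 * Λ n / Real.sqrt n / 2 * (I.indicator c.w (x - t) + I.indicator c.w (x + t))
            ≤ 2 * Λ n / Real.sqrt n / 2 * ((c.rangeMax (j + c.Am n) (j + c.Bm n) : ℝ) + c.rangeMax (j + c.Ap n) (j + c.Bp n)) :=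
              mul_le_mul_of_nonneg_left hsum (div_nonneg ha zero_le_two)
          _ ≤ (c.coef.hiAt n : ℝ) / 2 * ((c.rangeMax (j + c.Am n) (j + c.Bm n) : ℝ) + c.rangeMax (j + c.Ap n) (j + c.Bp n)) :=
              mul_le_mul_of_nonneg_right (div_le_div_of_nonneg_right hb zero_le_two) hR
      · -- not a prime power: the term vanishes
        rw [ArithmeticFunction.vonMangoldt_apply]
        simp only [hp, if_false, mul_zero, zero_div, zero_mul]
        exact mul_nonneg (div_nonneg h0 zero_le_two) (by exact_mod_cast add_nonneg hR1 hR2)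
    -- sum up
    have hrowj := hrow j hjK
    have hcast : ((c.rowSum j : ℚ) : ℝ) = ∑ n ∈ Finset.range (c.coef.N + 1),
        (((if c.coef.hiAt n = 0 then 0 else
          c.coef.hiAt n / 2 * (c.rangeMax (j + c.Am n) (j + c.Bm n) + c.rangeMax (j + c.Ap n) (j + c.Bp n))) : ℚ) : ℝ) := by
      unfold rowSum
      rw [← finset_sum_range_eq_list_sum, Rat.cast_sum]
    calc ∑ n ∈ Finset.range (c.coef.N + 1), 2 * Λ n / Real.sqrt n / 2 *
          (I.indicator c.w (x - Real.log n) + I.indicator c.w (x + Real.log n))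
        ≤ ∑ n ∈ Finset.range (c.coef.N + 1),
          (((if c.coef.hiAt n = 0 then 0 else
            c.coef.hiAt n / 2 * (c.rangeMax (j + c.Am n) (j + c.Bm n) + c.rangeMax (j + c.Ap n) (j + c.Bp n))) : ℚ) : ℝ) :=
          Finset.sum_le_sum hterm
      _ = ((c.rowSum j : ℚ) : ℝ) := hcast.symm
      _ ≤ ((c.Pup * c.wAt j : ℚ) : ℝ) := by exact_mod_cast hrowj
      _ = c.Pup * c.w x := by rw [hwx]; push_cast; ring

/-- **A passing certificate yields a Schur weight, hence the Krein–Turán bound.** [folklore] -/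
theorem kreinTuranBound (h : c.check = true) {N : ℕ} {L P : ℝ} (hN : c.coef.N = N) (hLr : (c.L : ℝ) = L)
    (hP : (c.Pup : ℝ) = P) : KreinTuranBound N L P :=
  kreinTuranBound_of_schurWeight (c.sound h hN hLr hP)

/-! ### Chunked checking (large certificates: the rows are verified in blocks, each by its own `decide +kernel`) -/

/-- Everything in `check` except the rows. [folklore] -/
def checkBase : Bool :=
  c.coef.check && decide (0 < c.K) && decide (0 < c.L) &&
    (List.range (c.coef.N + 1)).all (c.checkShift (FI.logTable c.coef.N)) &&
    (List.range c.K).all (fun i => decide (0 < c.wAt i))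

/-- The rows `a, …, a + n - 1`. [folklore] -/
def checkRows (a n : ℕ) : Bool :=
  (List.range' a n).all fun j => decide (c.rowSum j ≤ c.Pup * c.wAt j)

/-- A passing block of rows, unpacked. [folklore] -/
theorem checkRows_spec {a n : ℕ} (h : c.checkRows a n = true) {j : ℕ} (h1 : a ≤ j) (h2 : j < a + n) :
    c.rowSum j ≤ c.Pup * c.wAt j := by
  unfold checkRows at h
  rw [List.all_eq_true] at h
  have := h j (List.mem_range'.2 ⟨j - a, by omega, by omega⟩)
  rwa [decide_eq_true_eq] at this

/-- **Assembling `check` from the base check and the rows.** [folklore] -/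
theorem check_of_base_of_rows (hb : c.checkBase = true) (hr : ∀ j < c.K, c.rowSum j ≤ c.Pup * c.wAt j) :
    c.check = true := by
  unfold checkBase at hb
  unfold check
  simp only [Bool.and_eq_true, List.all_eq_true, List.mem_range, decide_eq_true_eq] at hb ⊢
  exact ⟨hb, hr⟩

end SchurCert

end Summit.RiemannHypothesis.RiemannHypothesis.Theorems.SignCone

end
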